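import Literature.AlgebraicGeometry.Resolution.LocalBlowup
import Literature.AlgebraicGeometry.Resolution.LocalModels
import Literature.AlgebraicGeometry.Resolution.ExcellentRings
import Mathlib.FieldTheory.IntermediateField.Adjoin.Basic
import Mathlib.LinearAlgebra.Dimension.Free
import Mathlib.RingTheory.Algebraic.Integral
import Mathlib.RingTheory.IntegralClosure.IntegrallyClosed
import Mathlib.RingTheory.Valuation.LocalSubring
import HarnessLib

/-!
# The frame of the reduction `Thm. 1.5 ⇒ Thm. 1.1`: finite generation of subfields, dimension of models, integrality

Topic: `Literature/AlgebraicGeometry/Resolution`. PROOF side of `CossartPiltant2019ReductionP`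
(`ArithmeticalThreefoldsLocal.lean`), input (C4), hypothesis `hDec` of
`cossartPiltant2019ReductionP_of_cjs_of_stableInertiaHensel` ([CoP1] Prop. 9.3, decomposition
layer). Three elementary facts about the FRAME of that reduction (a complete regular local `S`
of dimension three, an algebraically closed field `E` ALGEBRAIC over `S`, a valuation ring `O_E`
of `E` dominating `S` with residue field algebraic over that of `S`; models `S[t] ⊆ E` of
subfields `M ∋ S` and their local rings `locAtCentre S[t] O_E`), used by the assembly of the
decomposition layer (`DecompositionLayerAssembly.lean`):

* `mem_valuationSubring_of_isIntegral_model`, `model_toSubring_le_of_subset` — elements integral over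
  a model inside `O_E` lie in `O_E`; `S[t] ⊆ C` as soon as `t ⊆ C` for a subring `C ∋ S`;
* `exists_finset_le_closure_of_le` — **every subfield `M ∋ S` of `E` below a finitely
  generated one is finitely generated over `S`, by finitely many elements of `O_E`** (as `E` is
  algebraic over `S`, `M` is a finite extension of `Frac S`; invert the generators outside
  `O_E`): the (LU M) currency `M ≤ Subfield.closure (S ∪ t)` is always available;
* `ringKrullDim_localization_centre_eq_of_frame`, `ringKrullDim_locAtCentre_eq_of_frame` — **the
  local ring of every model at the centre of `O_E` has dimension `dim S`** (the dimension formula,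
  Matsumura Thm. 15.6, `ringKrullDim_localization_eq_of_isUniversallyCatenaryRing`, for the
  universally catenary `S`: the model is algebraic over `S`, its centre lies over `𝔪_S` and is
  residually algebraic) — what lets [CoP1]/[CP2019] re-apply three-dimensional statements to
  local uniformizations ("`R′` … has dimension three", HAL p. 27).

Everything is PROVED; no named facts, definitions, instances or notation are introduced.

## Sources

* V. Cossart, O. Piltant, J. Algebra 320 (2008) 1051–1082: §2 (models), proof of Prop. 9.3
  (HAL hal-00139124, pp. 8–9, 27–28). [CossartPiltant2008]
* V. Cossart, O. Piltant, J. Algebra 529 (2019) = arXiv:1412.0868, §4.1 (LU) and proof of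
  Prop. 4.10 (arXiv v1: Prop. 4.8). [CossartPiltant2019]
* H. Matsumura, *Commutative Ring Theory*, Thm. 15.6. [Matsumura1987]
-/

noncomputable section

open IsLocalRing Polynomial

namespace Literature.AlgebraicGeometry.Resolution

universe u

section Integral

variable {S : Type u} [CommRing S] {E : Type u} [Field E] [Algebra S E]

/-- **Valuation rings are integrally closed**, model form: an element of `E` integral over a
model `T ⊆ O_E` lies in `O_E` (used silently for the normal models of [CoP1] §2.1).
[cite: CossartPiltant2008, §2.1 (HAL pp. 8–9), normal local models] -/
theorem mem_valuationSubring_of_isIntegral_model (T : Subalgebra S E) (O : ValuationSubring E)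
    (hTO : T.toSubring ≤ O.toSubring) {x : E} (hx : IsIntegral T x) : x ∈ O := by
  letI : Algebra T O := ((T.val : T →+* E).codRestrict O.toSubring (fun a => hTO a.2)).toAlgebra
  haveI : IsScalarTower T O E := IsScalarTower.of_algebraMap_eq fun _ => rfl
  obtain ⟨w, hw⟩ := (IsIntegrallyClosed.isIntegral_iff (R := O) (K := E)).mp hx.tower_top
  rw [← hw]
  exact w.2

/-- `S[t] ⊆ C` for a subring `C` of `E` containing `S` and `t` (models of [CoP1] §2.1).
[cite: CossartPiltant2008, §2.1 (HAL pp. 8–9), models] -/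
theorem model_toSubring_le_of_subset {C : Subring E} (hSC : ∀ s : S, algebraMap S E s ∈ C)
    {t : Set E} (ht : t ⊆ C) : (Algebra.adjoin S t).toSubring ≤ C := by
  let CS : Subalgebra S E := { C with algebraMap_mem' := hSC }
  have h : Algebra.adjoin S t ≤ CS := Algebra.adjoin_le ht
  exact fun x hx => h hx

/-- A model `S[t]` with `t ⊆ O_E` lies in `O_E` (when `S ⊆ O_E`): the models "`⊆ W`" of
[CoP1] §2.1. [cite: CossartPiltant2008, §2.1 (HAL pp. 8–9), models] -/
theorem model_toSubring_le_valuationSubring (O : ValuationSubring E)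
    (hSO : ∀ s : S, algebraMap S E s ∈ O) {t : Set E} (ht : ∀ x ∈ t, x ∈ O) :
    (Algebra.adjoin S t).toSubring ≤ O.toSubring :=
  model_toSubring_le_of_subset (C := O.toSubring) hSO ht

/-- Elements integral over a model `S[t₀] ⊆ O_E` generate, together with `t₀`, a model inside
`O_E` (normal local models, [CoP1] §2.1). [cite: CossartPiltant2008, §2.1 (HAL pp. 8–9), normal local models] -/
theorem model_toSubring_le_valuationSubring_of_isIntegral (O : ValuationSubring E)
    (hSO : ∀ s : S, algebraMap S E s ∈ O) (t₀ : Set E)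
    (ht₀O : (Algebra.adjoin S t₀).toSubring ≤ O.toSubring) {t : Set E}
    (ht : ∀ x ∈ t, IsIntegral (Algebra.adjoin S t₀) x) :
    (Algebra.adjoin S t).toSubring ≤ O.toSubring :=
  model_toSubring_le_valuationSubring O hSO fun x hx =>
    mem_valuationSubring_of_isIntegral_model _ O ht₀O (ht x hx)

end Integral

/-! ## Subfields of `E ∋ S` below a finitely generated one are finitely generated over `S` -/

section FiniteGeneration

variable {S : Type u} [CommRing S] {E : Type u} [Field E] [Algebra S E]

/-- Elements of the subfield generated by `S` and `t` are fractions of elements of `S[t]`.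
[folklore] -/
private theorem exists_div_eq_of_mem_closure₃ (t : Set E) {z : E}
    (hz : z ∈ Subfield.closure (Set.range (algebraMap S E) ∪ t)) :
    ∃ a b : E, a ∈ Algebra.adjoin S t ∧ b ∈ Algebra.adjoin S t ∧ b ≠ 0 ∧ z = a / b := by
  obtain ⟨y, hy, w, hw, hyw⟩ := Subfield.mem_closure_iff.mp hz
  rw [← Algebra.adjoin_eq_ring_closure] at hy hw
  by_cases hw0 : w = 0
  · refine ⟨0, 1, zero_mem _, one_mem _, one_ne_zero, ?_⟩
    rw [← hyw, hw0, div_zero, zero_div]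
  · exact ⟨y, w, hy, hw, hw0, hyw.symm⟩

set_option maxHeartbeats 400000 in
/-- **Finite generation descends along finite field extensions, frame form.** Let `E` be a
field algebraic over `S` with `S → E` injective, `M ≤ K′` subfields of `E` containing `S`, and
`K′ ≤ Frac(S)(t)` for a finite `t`. Then `M ≤ Frac(S)(t₀)` for a finite `t₀ ⊆ M`, which may be
taken inside any valuation ring `O` of `E` (replace a generator outside `O` by its inverse).
Indeed `M` is a subspace of the finite extension `Frac(S)(t)` of `Frac S`.
[cite: CossartPiltant2008, §2.1 and proof of Prop. 9.3 (HAL pp. 8, 27)] -/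
theorem exists_finset_le_closure_of_le [Algebra.IsAlgebraic S E]
    (hinj : Function.Injective (algebraMap S E)) (O : ValuationSubring E)
    (M K' : Subfield E) (hSM : ∀ s : S, algebraMap S E s ∈ M) (hMK' : M ≤ K')
    (t : Finset E) (hK' : K' ≤ Subfield.closure (Set.range (algebraMap S E) ∪ (t : Set E))) :
    ∃ t₀ : Finset E, (t₀ : Set E) ⊆ M ∧ (∀ x ∈ t₀, x ∈ O) ∧
      M ≤ Subfield.closure (Set.range (algebraMap S E) ∪ (t₀ : Set E)) := by
  classical
  -- the field `F₀ = Frac S` inside `E`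
  let F₀ : Subfield E := Subfield.closure (Set.range (algebraMap S E))
  have hF₀M : F₀ ≤ M := Subfield.closure_le.mpr (by rintro _ ⟨s, rfl⟩; exact hSM s)
  letI : Algebra S F₀ :=
    ((algebraMap S E).codRestrict F₀ (fun s => Subfield.subset_closure ⟨s, rfl⟩)).toAlgebra
  haveI : IsScalarTower S F₀ E := IsScalarTower.of_algebraMap_eq fun _ => rfl
  have hSF₀ : Function.Injective (algebraMap S F₀) := fun a b hab => by
    apply hinj
    have := congrArg (fun z : F₀ => (z : E)) hab
    exact this
  -- `L = F₀(t)` is finite over `F₀`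
  let L : IntermediateField F₀ E := IntermediateField.adjoin F₀ (t : Set E)
  haveI : FiniteDimensional F₀ L := by
    refine IntermediateField.finiteDimensional_adjoin (fun x _ => ?_)
    have hx : IsAlgebraic F₀ x :=
      IsAlgebraic.extendScalars (R := S) hSF₀ (Algebra.IsAlgebraic.isAlgebraic x)
    exact hx.isIntegral
  -- `M` as an intermediate field `M′ ≤ L`
  let M' : IntermediateField F₀ E := M.toIntermediateField (fun x => hF₀M x.2)
  have hmemM' : ∀ x : E, x ∈ M' ↔ x ∈ M := fun x => Iff.rfl
  have hclL : Subfield.closure (Set.range (algebraMap S E) ∪ (t : Set E)) ≤ L.toSubfield := by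
    refine Subfield.closure_le.mpr ?_
    rintro y (⟨s, rfl⟩ | hy)
    · exact L.algebraMap_mem ⟨algebraMap S E s, Subfield.subset_closure ⟨s, rfl⟩⟩
    · exact IntermediateField.subset_adjoin F₀ _ hy
  have hM'L : M' ≤ L := fun x hx => hclL (hK' (hMK' ((hmemM' x).mp hx)))
  haveI : FiniteDimensional F₀ M' :=
    FiniteDimensional.of_injective (IntermediateField.inclusion hM'L).toLinearMap
      (IntermediateField.inclusion_injective hM'L)
  -- a basis of `M′` over `F₀`; invert the basis vectors outside `O`
  let b := Module.finBasis F₀ M'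
  let t₁ : Finset E := Finset.univ.image (fun i => ((b i : M') : E))
  let t₀ : Finset E := t₁.image (fun y => if y ∈ O then y else y⁻¹)
  have ht₁M : ∀ y ∈ t₁, y ∈ M := by
    intro y hy
    obtain ⟨i, -, rfl⟩ := Finset.mem_image.mp hy
    exact (b i).2
  refine ⟨t₀, ?_, ?_, ?_⟩
  · intro y hy
    obtain ⟨z, hz, rfl⟩ := Finset.mem_image.mp (Finset.mem_coe.mp hy)
    split_ifs
    · exact ht₁M z hz
    · exact M.inv_mem (ht₁M z hz)
  · intro y hy
    obtain ⟨z, hz, rfl⟩ := Finset.mem_image.mp hy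
    split_ifs with h
    · exact h
    · exact (O.mem_or_inv_mem z).resolve_left h
  · -- `t₁ ⊆ Frac(S)(t₀)`
    set T : Subfield E := Subfield.closure (Set.range (algebraMap S E) ∪ (t₀ : Set E)) with hT
    have ht₁T : ∀ y ∈ t₁, y ∈ T := by
      intro y hy
      by_cases hyO : y ∈ O
      · refine Subfield.subset_closure (Or.inr ?_)
        exact Finset.mem_coe.mpr (Finset.mem_image.mpr ⟨y, hy, by rw [if_pos hyO]⟩)
      · have : y⁻¹ ∈ (t₀ : Set E) :=
          Finset.mem_coe.mpr (Finset.mem_image.mpr ⟨y, hy, by rw [if_neg hyO]⟩)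
        rw [← inv_inv y]
        exact T.inv_mem (Subfield.subset_closure (Or.inr this))
    have hF₀T : F₀ ≤ T := Subfield.closure_mono Set.subset_union_left
    -- every element of `M′` is an `F₀`-combination of the basis
    intro x hx
    have hxspan := b.mem_span (⟨x, hx⟩ : M')
    suffices h : ∀ y : M', y ∈ Submodule.span F₀ (Set.range b) → (y : E) ∈ T from
      h ⟨x, hx⟩ hxspan
    intro y hy
    induction hy using Submodule.span_induction with
    | mem z hz =>
      obtain ⟨i, rfl⟩ := hz
      exact ht₁T _ (Finset.mem_image.mpr ⟨i, Finset.mem_univ _, rfl⟩)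
    | zero => exact T.zero_mem
    | add z w _ _ hz hw =>
      rw [IntermediateField.coe_add]
      exact T.add_mem hz hw
    | smul c z _ hz =>
      rw [IntermediateField.coe_smul, Algebra.smul_def]
      exact T.mul_mem (hF₀T c.2) hz

end FiniteGeneration

/-! ## Dimension of the local rings of models -/

section Dimension

variable {S : Type u} [CommRing S] [IsDomain S] [IsLocalRing S] {E : Type u} [Field E]
  [Algebra S E]

/-- **`dim (S[t])_𝔪 = dim S` in the frame** (the dimension formula): for `S` a universally
catenary local domain, `E` a field algebraic over `S` with `S → E` injective, `O` a valuation
ring of `E` dominating `S` with residue field algebraic over that of `S`, and any finitely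
generated model `T = S[t] ⊆ O`, the localization of `T` at the centre `𝔪_O ∩ T` has dimension
`dim S`. [cite: Matsumura1987, Thm. 15.6]
[cite: CossartPiltant2008, proof of Prop. 9.3 (HAL p. 27), "is of dimension three"] -/
theorem ringKrullDim_localization_centre_eq_of_frame [Algebra.IsAlgebraic S E]
    (hSuc : IsUniversallyCatenaryRing S) (hinj : Function.Injective (algebraMap S E))
    (O : ValuationSubring E) (hSO : ∀ s : S, algebraMap S E s ∈ O)
    (hdom : ∀ s ∈ maximalIdeal S, O.valuation (algebraMap S E s) < 1)
    (hres : ∀ y : O, ∃ q : S[X], (∃ i, q.coeff i ∉ maximalIdeal S) ∧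
      O.valuation (q.eval₂ (algebraMap S E) y) < 1)
    (T : Subalgebra S E) [Algebra.FiniteType S T] (hTO : T.toSubring ≤ O.toSubring) :
    ringKrullDim (Localization.AtPrime
      (Ideal.comap (Subring.inclusion hTO) (maximalIdeal O))) = ringKrullDim S := by
  let P : Ideal T := Ideal.comap (Subring.inclusion hTO) (maximalIdeal O)
  haveI hPp : P.IsPrime := Ideal.IsPrime.comap _
  have hP : ∀ z : T, z ∈ P ↔ O.valuation (z : E) < 1 := fun z => by
    change Subring.inclusion hTO z ∈ maximalIdeal O ↔ _
    rw [ValuationSubring.valuation_lt_one_iff]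
    rfl
  haveI := liesOver_maximalIdeal_of_forall_valuation_lt_one O hSO hdom T P hP
  haveI := isAlgebraic_quotient_of_forall_valuation_lt_one O hres T (fun x => hTO x.2) P hP
  haveI : FaithfulSMul S T := (faithfulSMul_iff_algebraMap_injective _ _).mpr fun a b h =>
    hinj (congrArg Subtype.val h)
  haveI : Algebra.IsAlgebraic S T :=
    Algebra.IsAlgebraic.of_injective T.val Subtype.val_injective
  exact ringKrullDim_localization_eq_of_isUniversallyCatenaryRing hSuc P

/-- The same for the local ring `locAtCentre S[t] O ⊆ E`. [cite: Matsumura1987, Thm. 15.6] -/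
theorem ringKrullDim_locAtCentre_eq_of_frame [Algebra.IsAlgebraic S E]
    (hSuc : IsUniversallyCatenaryRing S) (hinj : Function.Injective (algebraMap S E))
    (O : ValuationSubring E) (hSO : ∀ s : S, algebraMap S E s ∈ O)
    (hdom : ∀ s ∈ maximalIdeal S, O.valuation (algebraMap S E s) < 1)
    (hres : ∀ y : O, ∃ q : S[X], (∃ i, q.coeff i ∉ maximalIdeal S) ∧
      O.valuation (q.eval₂ (algebraMap S E) y) < 1)
    (T : Subalgebra S E) [Algebra.FiniteType S T] (hTO : T.toSubring ≤ O.toSubring) :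
    ringKrullDim (locAtCentre T.toSubring O) = ringKrullDim S := by
  rw [← ringKrullDim_localization_centre_eq_of_frame hSuc hinj O hSO hdom hres T hTO]
  exact ringKrullDim_eq_of_ringEquiv (locAtCentreEquiv hTO).toRingEquiv.symm

end Dimension

/-! ## A regular local model is integrally closed in its fraction field, inside `E` -/

section Normal

variable {S : Type u} [CommRing S] {E : Type u} [Field E] [Algebra S E]

/-- The local ring `locAtCentre T O` of a model `T ⊆ K` lies in the subfield `K` (local models
of `K`, [CoP1] §2.1). [cite: CossartPiltant2008, §2.1 (HAL pp. 8–9), local models] -/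
theorem locAtCentre_le_subfield (T : Subring E) (O : ValuationSubring E) (K : Subfield E)
    (hTK : T ≤ K.toSubring) : locAtCentre T O ≤ K.toSubring := by
  rintro _ ⟨y, hy, z, hz, -, rfl⟩
  exact K.div_mem (hTK hy) (hTK hz)

/-- **Regular local rings are normal, model form** (Matsumura Thm. 19.4): if the local ring
`S′ = locAtCentre T O` of a model `T` with fraction field `K ⊆ E` is regular, then every
element of `K` integral over `S′` lies in `S′`. [cite: Matsumura1987, Thm. 19.4] -/
theorem mem_locAtCentre_of_isIntegral (T : Subalgebra S E) (O : ValuationSubring E)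
    (hreg : IsRegularLocalRing (locAtCentre T.toSubring O))
    (K : Subfield E) (hTK : T.toSubring ≤ K.toSubring)
    (hK : ∀ z ∈ K, ∃ a ∈ T.toSubring, ∃ b ∈ T.toSubring, b ≠ 0 ∧ z = a / b)
    {x : E} (hxK : x ∈ K) (hx : IsIntegral (locAtCentre T.toSubring O) x) :
    x ∈ locAtCentre T.toSubring O := by
  set S' : Subring E := locAtCentre T.toSubring O with hS'def
  haveI : IsRegularLocalRing S' := hreg
  haveI : IsIntegrallyClosed S' := isIntegrallyClosed_of_isRegularLocalRing S'
  have hS'K : S' ≤ K.toSubring := locAtCentre_le_subfield T.toSubring O K hTK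
  letI : Algebra S' K := (Subring.inclusion hS'K).toAlgebra
  haveI : IsScalarTower S' K E := IsScalarTower.of_algebraMap_eq fun _ => rfl
  have hinjK : Function.Injective (algebraMap S' K) := fun a b hab => by
    apply Subtype.ext
    have := congrArg (fun z : K => (z : E)) hab
    exact this
  haveI : FaithfulSMul S' K := (faithfulSMul_iff_algebraMap_injective S' K).mpr hinjK
  haveI : IsFractionRing S' K := by
    refine IsFractionRing.of_field S' K fun z => ?_
    obtain ⟨a, ha, b, hb, -, hz⟩ := hK z z.2
    exact ⟨⟨a, le_locAtCentre _ _ ha⟩, ⟨b, le_locAtCentre _ _ hb⟩, Subtype.ext hz⟩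
  have hx' : IsIntegral S' (⟨x, hxK⟩ : K) :=
    (isIntegral_algHom_iff (IsScalarTower.toAlgHom S' K E) (fun a b h => Subtype.ext h)).mp hx
  obtain ⟨y, hy⟩ := (IsIntegrallyClosed.isIntegral_iff (R := S') (K := K)).mp hx'
  have : (y : E) = x := congrArg (fun z : K => (z : E)) hy
  rw [← this]
  exact y.2

end Normal

end Literature.AlgebraicGeometry.Resolution

end
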